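import Mathlib.Analysis.Calculus.FDeriv.Symmetric
import Mathlib.MeasureTheory.Integral.IntervalIntegral.FundThmCalculus
import Mathlib.Analysis.ODE.Gronwall
import Mathlib.Analysis.MeanInequalities
import Mathlib.Analysis.FunctionalSpaces.SobolevInequality
import Literature.Analysis.FluidPDE.ClassicalSolutionCalculus
import Literature.Analysis.FluidPDE.CoordDerivatives
import HarnessLib

/-!
# Toolkit for energy methods: mixed partials in space–time, time integration, Grönwall,
# and real-variable forms of the Hölder, Gagliardo–Nirenberg–Sobolev and Young inequalities

Analysis/FluidPDE support file (folklore real analysis), the second of five files discharging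
`Literature.Analysis.FluidPDE.tao2011_hasBoundedSobolevNormsOn_of_memSobolevX` (Tao 2011, Cor. 4.3 + Thm. 5.4 (iv))
by the vorticity energy method for classical solutions
(`CoordDerivatives` → `EnergyToolkit` → `NSVorticityEnergy` → `NSVorticitySlice` →
`NSEnstrophyPersistence`). Everything here is independent of the Navier–Stokes equations.

* **Space–time calculus** for jointly smooth fields `w : ℝ → X → F` on a time set `S`
  (`IsSmoothSpaceTimeOn`, `Fluid.timeDerivWithin` of `ClassicalSolutionCalculus`): mixed
  partials commute, `∂ₜ (D(w ·)(x) v) = D(∂ₜ w)(x) v` (`timeDerivWithin_fderiv_slice_apply`, from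
  the symmetry of the second derivative of `uncurry w` within `S × X`, Mathlib's
  `ContDiffWithinAt.isSymmSndFDerivWithinAt`; `S ⊆ closure (interior S)` and unique
  differentiability, e.g. `S = Icc 0 T`), hence `∂ₜ∂ₗ = ∂ₗ∂ₜ` and `∂ₜ∂^α = ∂^α∂ₜ` for the
  coordinate derivatives of `CoordDerivatives` (`timeDerivWithin_pderiv_slice`,
  `timeDerivWithin_ipderiv_slice`); linearity of `∂ₜ`, compatibility with continuous linear maps
  and with Euclidean components.
* **Time integration**: for a field jointly smooth on `[0, T] × E` and a continuous compactly
  supported weight `φ`, `∫_{(s,t)} ∫ φ ⟪∂ₜw, w⟫ = ½ ∫ φ ‖w(t)‖² − ½ ∫ φ ‖w(s)‖²`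
  (`integral_Ioo_integral_mul_inner_timeDerivWithin`; fundamental theorem of calculus on time
  lines and Fubini over the compact support; scalar form `…_mul_timeDerivWithin_mul`), and
  continuity of `t ↦ ∫ φ G(t, ·)` for jointly continuous `G`
  (`continuousOn_integral_mul_of_continuousOn`).
* **Inequalities in real-integral (Bochner) form**: Cauchy–Schwarz for `MemLp _ 2` functions
  (`integral_norm_mul_norm_le_sqrt_mul_sqrt`), the `L⁴` interpolation
  `∫‖g‖⁴ ≤ (∫‖g‖²)^{1/2} (∫‖g‖⁶)^{1/2}`, weighted AM–GM with a free parameter `ε > 0`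
  (`rpow_amgm₃`: `a^{1/2} b^{1/8} c^{3/8} ≤ ½a + ⅛ε⁻³b + ⅜εc`; `rpow_amgm₄`), Mathlib's
  Gagliardo–Nirenberg–Sobolev inequality (`eLpNorm_le_eLpNorm_fderiv_of_eq_inner`, `p = 2`,
  `p* = 6`, `finrank = 3`, constant `K = eLpNormLESNormFDerivOfEqInnerConst μ 2`) for `C¹`
  compactly supported maps in the forms `(∫‖Φ‖⁶)^{1/6} ≤ K (∫‖DΦ‖²)^{1/2}`,
  `∫‖Φ‖⁶ ≤ K⁶ (∫‖DΦ‖²)³`, `∫‖Φ‖⁴ ≤ (∫‖Φ‖²)^{1/2} K³ (∫‖DΦ‖²)^{3/2}`, and the trilinear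
  Hölder `(2, 3, 6)`–Sobolev estimate
  `∫ ‖f‖ ‖Φ₁‖ ‖Φ₂‖ ≤ ‖f‖₂ K^{3/2} (‖Φ₁‖₂²‖Φ₂‖₂²)^{1/8} (‖DΦ₁‖₂²‖DΦ₂‖₂²)^{3/8}`
  (`integral_norm_mul_norm_mul_norm_le_rpow`; with Young's inequality folded in,
  `integral_norm_mul_norm_mul_norm_le`).
* **Grönwall's inequality in integral form**: `Z ≤ A + C ∫₀ᵗ Z` on `[0, T]` with `Z` continuous and
  `C ≥ 0` gives `Z(t) ≤ A e^{Ct}` (`le_mul_exp_of_le_add_mul_integral`, from Mathlib's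
  `le_gronwallBound_of_liminf_deriv_right_le` applied to the primitive of `Z`).

## Mathlib search

Mathlib (this pin) provides the ingredients used here — `IsSymmSndFDerivWithinAt`,
`intervalIntegral.integral_eq_sub_of_hasDerivAt`-type FTC, `integral_prod`/Fubini, Hölder
(`MeasureTheory.integral_mul_le_Lp_mul_Lq_of_nonneg`, `eLpNorm_le_eLpNorm_mul_rpow_measure_univ`),
the GNS inequality (`Mathlib/Analysis/FunctionalSpaces/SobolevInequality.lean`) and
`gronwallBound` — but states them for `eLpNorm`/`ℝ≥0∞` or in differential form; the lemmas below
are the real-valued repackagings needed to run an energy estimate by `linarith`/`nlinarith`.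
Tree: `SpaceTimeCalculus` has the exchange of `∂ₜ` and `D` on an *open* time set (two-sided
`deriv`, `deriv_fderiv_slice_eq_fderiv_deriv`); the version here is the one-sided
`timeDerivWithin` form on sets like the closed slab `Icc 0 T` (endpoints included), which is what
`IsClassicalNSSolutionOn (Icc 0 T)` provides; `NSVorticityDifference` has
`IsSmoothSpaceTimeOn.timeDerivWithin_sub` for `w₁ - w₂` (Pi subtraction), the `fun`-form here is
named `timeDerivWithin_fun_sub` to coexist. No new definitions.

## References

* A. J. Majda, A. L. Bertozzi, *Vorticity and Incompressible Flow*, CUP (2002)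
  (`MajdaBertozzi2002`), §3.1, Lemma 3.1 (Grönwall's lemma; held copy p. 78) and §3.2,
  proof of Prop. 3.7 (the pattern `(D^α vₜ, D^α v)`, integration by parts, calculus
  inequalities, Grönwall; held copy p. 93). [folklore]
* Mathlib, `Mathlib/Analysis/FunctionalSpaces/SobolevInequality.lean`
  (`MeasureTheory.eLpNorm_le_eLpNorm_fderiv_of_eq_inner`: the Gagliardo–Nirenberg–Sobolev
  inequality with constant `eLpNormLESNormFDerivOfEqInnerConst`). [folklore]
-/

noncomputable section

open MeasureTheory Set Function Filter Topology
open scoped ENNReal NNReal ContDiff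

namespace Literature.Analysis.FluidPDE

/-! ## Mixed partial derivatives of jointly smooth space–time fields commute -/

section SpaceTime

variable {X : Type*} [NormedAddCommGroup X] [NormedSpace ℝ X]
variable {F : Type*} [NormedAddCommGroup F] [NormedSpace ℝ F]
variable {S : Set ℝ} {w : ℝ → X → F}

/-- The slice directional derivatives `(t, x) ↦ D(w t)(x) v` of a jointly smooth field are jointly
smooth (`S` of unique differentiability). [folklore] -/
theorem IsSmoothSpaceTimeOn.fderiv_slice_apply (h : IsSmoothSpaceTimeOn S w)
    (hS : UniqueDiffOn ℝ S) (v : X) :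
    IsSmoothSpaceTimeOn S (fun t x => fderiv ℝ (w t) x v) :=
  (h.fderiv_slice hS).clm_apply (v := fun _ _ => v) contDiffOn_const

/-- **Mixed partials commute** (Schwarz in space–time, one-sided in time): for a field `w`
jointly `C^∞` on `S × X`, `S` a time set of unique differentiability contained in the closure of
its interior (e.g. any interval `Icc a b`, `a < b`), and `t ∈ S`,
`∂ₜ (D(w ·)(x) v) (t) = D(∂ₜ w (t)) (x) v`, where `∂ₜ = timeDerivWithin S`. Proof: both sides
are values of the second derivative of `uncurry w` within `S × X` at `(t, x)` on the pair
`((1, 0), (0, v))`, which is symmetric (`ContDiffWithinAt.isSymmSndFDerivWithinAt`). [folklore] -/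
theorem IsSmoothSpaceTimeOn.timeDerivWithin_fderiv_slice_apply (h : IsSmoothSpaceTimeOn S w)
    (hS : UniqueDiffOn ℝ S) (hcl : S ⊆ closure (interior S)) {t : ℝ} (ht : t ∈ S) (x v : X) :
    FluidPDE.timeDerivWithin S (fun s y => fderiv ℝ (w s) y v) t x =
      fderiv ℝ (FluidPDE.timeDerivWithin S w t) x v := by
  set W : ℝ × X → F := uncurry w with hW
  set s : Set (ℝ × X) := S ×ˢ (univ : Set X) with hs
  have hU : UniqueDiffOn ℝ s := hS.prod uniqueDiffOn_univ
  have htx : (t, x) ∈ s := mk_mem_prod ht (mem_univ x)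
  set A : ℝ × X → (ℝ × X →L[ℝ] F) := fderivWithin ℝ W s with hA
  have hAdiff : ContDiffOn ℝ ∞ A s := h.fderivWithin hU (by simp)
  have hA_at : HasFDerivWithinAt A (fderivWithin ℝ A s (t, x)) s (t, x) :=
    ((hAdiff (t, x) htx).differentiableWithinAt (by simp)).hasFDerivWithinAt
  -- symmetry of the second derivative within `s`
  have hsymm : IsSymmSndFDerivWithinAt ℝ W s (t, x) := by
    refine (h (t, x) htx).isSymmSndFDerivWithinAt
      (by rw [minSmoothness_of_isRCLikeNormedField]; exact WithTop.coe_le_coe.2 le_top) hU ?_ htx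
    change (t, x) ∈ closure (interior (S ×ˢ (univ : Set X)))
    rw [interior_prod_eq, interior_univ, closure_prod_eq, closure_univ]
    exact mk_mem_prod (hcl ht) (mem_univ x)
  -- (1) slices: `D(w s')(y) v = A (s', y) (0, v)` and `∂ₜ w s' y = A (s', y) (1, 0)` on `S`
  have e1 : ∀ s' ∈ S, ∀ y, fderiv ℝ (w s') y v = A (s', y) ((0 : ℝ), v) := fun s' hs' y => by
    rw [h.fderiv_slice_eq hs' y]
    rfl
  have e2 : ∀ y, FluidPDE.timeDerivWithin S w t y = A (t, y) ((1 : ℝ), (0 : X)) := fun y =>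
    h.timeDerivWithin_eq hS ht y
  -- (2) the left-hand side is `(D A (t,x) (1,0)) (0,v)`
  have hL : FluidPDE.timeDerivWithin S (fun s y => fderiv ℝ (w s) y v) t x =
      (fderivWithin ℝ A s (t, x) ((1 : ℝ), (0 : X))) ((0 : ℝ), v) := by
    rw [timeDerivWithin_apply]
    have hcongr : derivWithin (fun s' => fderiv ℝ (w s') x v) S t =
        derivWithin (fun s' => A (s', x) ((0 : ℝ), v)) S t :=
      derivWithin_congr (fun s' hs' => e1 s' hs' x) (e1 t ht x)
    rw [hcongr]
    have h2 : HasDerivWithinAt (fun s' : ℝ => ((s', x) : ℝ × X)) ((1 : ℝ), (0 : X)) S t :=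
      (hasDerivWithinAt_id t S).prodMk (hasDerivWithinAt_const t S x)
    have h3 : HasDerivWithinAt (fun s' => A (s', x))
        (fderivWithin ℝ A s (t, x) ((1 : ℝ), (0 : X))) S t :=
      hA_at.comp_hasDerivWithinAt t h2 fun s' hs' => mk_mem_prod hs' (mem_univ x)
    have h4 : HasDerivWithinAt (fun s' => A (s', x) ((0 : ℝ), v))
        ((fderivWithin ℝ A s (t, x) ((1 : ℝ), (0 : X))) ((0 : ℝ), v)) S t := by
      have := h3.clm_apply (hasDerivWithinAt_const t S (((0 : ℝ), v) : ℝ × X))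
      simpa using this
    exact h4.derivWithin (hS t ht)
  -- (3) the right-hand side is `(D A (t,x) (0,v)) (1,0)`
  have hR : fderiv ℝ (FluidPDE.timeDerivWithin S w t) x v =
      (fderivWithin ℝ A s (t, x) ((0 : ℝ), v)) ((1 : ℝ), (0 : X)) := by
    have hfun : FluidPDE.timeDerivWithin S w t = fun y => A (t, y) ((1 : ℝ), (0 : X)) := funext e2
    rw [hfun]
    have h2 : HasFDerivAt (fun y : X => ((t, y) : ℝ × X)) (ContinuousLinearMap.inr ℝ ℝ X) x :=
      hasFDerivAt_prodMk_right t x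
    have h3 : HasFDerivAt (fun y => A (t, y))
        ((fderivWithin ℝ A s (t, x)).comp (ContinuousLinearMap.inr ℝ ℝ X)) x :=
      hA_at.comp_hasFDerivAt x h2 (Eventually.of_forall fun y => mk_mem_prod ht (mem_univ y))
    have h4 : HasFDerivAt (fun y => A (t, y) ((1 : ℝ), (0 : X)))
        (((fderivWithin ℝ A s (t, x)).comp (ContinuousLinearMap.inr ℝ ℝ X)).flip
          ((1 : ℝ), (0 : X))) x := by
      have := h3.clm_apply (hasFDerivAt_const (((1 : ℝ), (0 : X)) : ℝ × X) x)
      simpa using this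
    rw [h4.fderiv]
    simp
  rw [hL, hR]
  exact hsymm _ _

omit [NormedAddCommGroup X] [NormedSpace ℝ X] in
/-- The one-sided time derivative within `S` only depends on the values of the field on `S`. [folklore] -/
theorem timeDerivWithin_congr_on {w₁ w₂ : ℝ → X → F} (hw : ∀ s ∈ S, ∀ y, w₁ s y = w₂ s y) {t : ℝ}
    (ht : t ∈ S) (x : X) : FluidPDE.timeDerivWithin S w₁ t x = FluidPDE.timeDerivWithin S w₂ t x := by
  rw [timeDerivWithin_apply, timeDerivWithin_apply]
  exact derivWithin_congr (fun s hs => hw s hs x) (hw t ht x)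

/-- Time derivatives of differences of jointly smooth fields (`S` of unique differentiability). [folklore] -/
theorem IsSmoothSpaceTimeOn.timeDerivWithin_fun_sub {w₁ w₂ : ℝ → X → F} (h₁ : IsSmoothSpaceTimeOn S w₁)
    (h₂ : IsSmoothSpaceTimeOn S w₂) (hS : UniqueDiffOn ℝ S) {t : ℝ} (ht : t ∈ S) (x : X) :
    FluidPDE.timeDerivWithin S (fun s y => w₁ s y - w₂ s y) t x =
      FluidPDE.timeDerivWithin S w₁ t x - FluidPDE.timeDerivWithin S w₂ t x := by
  rw [timeDerivWithin_apply]
  exact ((h₁.hasDerivWithinAt_timeDerivWithin hS ht x).sub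
    (h₂.hasDerivWithinAt_timeDerivWithin hS ht x)).derivWithin (hS t ht)

/-- Time derivatives of sums of jointly smooth fields (`S` of unique differentiability). [folklore] -/
theorem IsSmoothSpaceTimeOn.timeDerivWithin_fun_add {w₁ w₂ : ℝ → X → F} (h₁ : IsSmoothSpaceTimeOn S w₁)
    (h₂ : IsSmoothSpaceTimeOn S w₂) (hS : UniqueDiffOn ℝ S) {t : ℝ} (ht : t ∈ S) (x : X) :
    FluidPDE.timeDerivWithin S (fun s y => w₁ s y + w₂ s y) t x =
      FluidPDE.timeDerivWithin S w₁ t x + FluidPDE.timeDerivWithin S w₂ t x := by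
  rw [timeDerivWithin_apply]
  exact ((h₁.hasDerivWithinAt_timeDerivWithin hS ht x).add
    (h₂.hasDerivWithinAt_timeDerivWithin hS ht x)).derivWithin (hS t ht)

/-- Time derivatives of constant multiples (`S` of unique differentiability). [folklore] -/
theorem IsSmoothSpaceTimeOn.timeDerivWithin_fun_const_mul {w : ℝ → X → ℝ} (h : IsSmoothSpaceTimeOn S w)
    (hS : UniqueDiffOn ℝ S) (c : ℝ) {t : ℝ} (ht : t ∈ S) (x : X) :
    FluidPDE.timeDerivWithin S (fun s y => c * w s y) t x = c * FluidPDE.timeDerivWithin S w t x := by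
  rw [timeDerivWithin_apply]
  exact ((h.hasDerivWithinAt_timeDerivWithin hS ht x).const_mul c).derivWithin (hS t ht)

/-- Applying a fixed continuous linear map to a jointly smooth field gives a jointly smooth field. [folklore] -/
theorem IsSmoothSpaceTimeOn.clm_comp {G : Type*} [NormedAddCommGroup G] [NormedSpace ℝ G]
    (h : IsSmoothSpaceTimeOn S w) (L : F →L[ℝ] G) : IsSmoothSpaceTimeOn S (fun t x => L (w t x)) :=
  IsSmoothSpaceTimeOn.clm_apply (L := fun _ _ => L) contDiffOn_const h

/-- Time derivative of `L ∘ w` for a fixed continuous linear map `L` (`S` of unique differentiability). [folklore] -/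
theorem IsSmoothSpaceTimeOn.timeDerivWithin_clm_comp {G : Type*} [NormedAddCommGroup G]
    [NormedSpace ℝ G] (h : IsSmoothSpaceTimeOn S w) (hS : UniqueDiffOn ℝ S) (L : F →L[ℝ] G)
    {t : ℝ} (ht : t ∈ S) (x : X) :
    FluidPDE.timeDerivWithin S (fun s y => L (w s y)) t x = L (FluidPDE.timeDerivWithin S w t x) := by
  rw [timeDerivWithin_apply]
  exact (L.hasFDerivAt.comp_hasDerivWithinAt t
    (h.hasDerivWithinAt_timeDerivWithin hS ht x)).derivWithin (hS t ht)

end SpaceTime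

/-! ## Coordinates: components, partial derivatives and word derivatives of space–time fields -/

section Coord

variable {ι : Type*} [Fintype ι] [DecidableEq ι]
variable {S : Set ℝ}


/-- Components of a jointly smooth `ℝ^κ`-valued field are jointly smooth. [folklore] -/
theorem IsSmoothSpaceTimeOn.euclidean_comp {X : Type*} [NormedAddCommGroup X] [NormedSpace ℝ X]
    {κ : Type*} [Fintype κ] {u : ℝ → X → EuclideanSpace ℝ κ} (h : IsSmoothSpaceTimeOn S u) (c : κ) :
    IsSmoothSpaceTimeOn S (fun t x => u t x c) :=
  h.clm_comp (EuclideanSpace.proj c)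

/-- Time derivative of a component = component of the time derivative. [folklore] -/
theorem IsSmoothSpaceTimeOn.timeDerivWithin_euclidean_comp {X : Type*} [NormedAddCommGroup X]
    [NormedSpace ℝ X] {κ : Type*} [Fintype κ] {u : ℝ → X → EuclideanSpace ℝ κ}
    (h : IsSmoothSpaceTimeOn S u) (hS : UniqueDiffOn ℝ S) (c : κ) {t : ℝ} (ht : t ∈ S) (x : X) :
    FluidPDE.timeDerivWithin S (fun s y => u s y c) t x = FluidPDE.timeDerivWithin S u t x c :=
  h.timeDerivWithin_clm_comp hS (EuclideanSpace.proj c) ht x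

variable {w : ℝ → EuclideanSpace ℝ ι → ℝ}

/-- Slice partial derivatives `(t, x) ↦ ∂ₗ (w t) (x)` of a jointly smooth scalar field are jointly
smooth (`S` of unique differentiability). [folklore] -/
theorem IsSmoothSpaceTimeOn.pderiv_slice (h : IsSmoothSpaceTimeOn S w) (hS : UniqueDiffOn ℝ S)
    (l : ι) : IsSmoothSpaceTimeOn S (fun t x => pderiv l (w t) x) :=
  h.fderiv_slice_apply hS (stdVec l)

/-- Slice word derivatives `(t, x) ↦ ∂^α (w t) (x)` of a jointly smooth scalar field are jointly
smooth (`S` of unique differentiability). [folklore] -/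
theorem IsSmoothSpaceTimeOn.ipderiv_slice (h : IsSmoothSpaceTimeOn S w) (hS : UniqueDiffOn ℝ S) :
    ∀ {m : ℕ} (α : Fin m → ι), IsSmoothSpaceTimeOn S (fun t x => ipderiv α (w t) x)
  | 0, _ => h
  | _ + 1, α => (IsSmoothSpaceTimeOn.ipderiv_slice h hS (Fin.tail α)).pderiv_slice hS (α 0)

/-- **`∂ₜ ∂ₗ = ∂ₗ ∂ₜ`** for jointly smooth scalar fields (`S` of unique differentiability, contained
in the closure of its interior). [folklore] -/
theorem IsSmoothSpaceTimeOn.timeDerivWithin_pderiv_slice (h : IsSmoothSpaceTimeOn S w)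
    (hS : UniqueDiffOn ℝ S) (hcl : S ⊆ closure (interior S)) {t : ℝ} (ht : t ∈ S) (x : EuclideanSpace ℝ ι)
    (l : ι) :
    FluidPDE.timeDerivWithin S (fun s y => pderiv l (w s) y) t x =
      pderiv l (FluidPDE.timeDerivWithin S w t) x :=
  h.timeDerivWithin_fderiv_slice_apply hS hcl ht x (stdVec l)

/-- **`∂ₜ ∂^α = ∂^α ∂ₜ`** for jointly smooth scalar fields. [folklore] -/
theorem IsSmoothSpaceTimeOn.timeDerivWithin_ipderiv_slice (h : IsSmoothSpaceTimeOn S w)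
    (hS : UniqueDiffOn ℝ S) (hcl : S ⊆ closure (interior S)) :
    ∀ {m : ℕ} (α : Fin m → ι) {t : ℝ} (_ : t ∈ S) (x : EuclideanSpace ℝ ι),
      FluidPDE.timeDerivWithin S (fun s y => ipderiv α (w s) y) t x =
        ipderiv α (FluidPDE.timeDerivWithin S w t) x
  | 0, _, _, _, _ => rfl
  | m + 1, α, t, ht, x => by
      have hw' := h.ipderiv_slice hS (Fin.tail α)
      have e1 := hw'.timeDerivWithin_pderiv_slice hS hcl ht x (α 0)
      have e2 : FluidPDE.timeDerivWithin S (fun s y => ipderiv (Fin.tail α) (w s) y) t =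
          ipderiv (Fin.tail α) (FluidPDE.timeDerivWithin S w t) :=
        funext fun y => IsSmoothSpaceTimeOn.timeDerivWithin_ipderiv_slice h hS hcl (Fin.tail α) ht y
      rw [e2] at e1
      exact e1

end Coord

/-! ## Time integration of `∫ φ ⟪∂ₜ w, w⟫` and continuity of localised space integrals -/

section TimeIntegration

variable {E : Type*} [NormedAddCommGroup E] [InnerProductSpace ℝ E] [FiniteDimensional ℝ E]
  [MeasurableSpace E] [BorelSpace E]
variable {F' : Type*} [NormedAddCommGroup F'] [InnerProductSpace ℝ F']

open scoped RealInnerProductSpace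

/-- **Continuity in time of localised space integrals**: for `G` continuous on `[a, b] × E` and a
continuous compactly supported weight `φ`, `t ↦ ∫ φ(x) G(t, x) dx` is continuous on `[a, b]`
(Mathlib `continuousOn_integral_of_compact_support`). [folklore] -/
theorem continuousOn_integral_mul_of_continuousOn {G : ℝ × E → ℝ} {a b : ℝ} {φ : E → ℝ}
    (hφ : Continuous φ) (hc : HasCompactSupport φ) (hG : ContinuousOn G (Icc a b ×ˢ univ)) :
    ContinuousOn (fun t => ∫ x, φ x * G (t, x)) (Icc a b) := by
  refine continuousOn_integral_of_compact_support (k := tsupport φ) (μ := volume) hc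
    ((hφ.comp continuous_snd).continuousOn.mul hG) fun t x _ hx => ?_
  simp [image_eq_zero_of_notMem_tsupport hx]

/-- **Time integration of `∫ φ ⟪∂ₜ w, w⟫`.** For a field `w` jointly smooth on `[0, T] × E`, a
continuous compactly supported weight `φ` and `0 ≤ s ≤ t ≤ T`:
`∫ₛᵗ ∫ φ ⟪∂ₜ w, w⟫ dx dτ = ½ ∫ φ ‖w(t)‖² − ½ ∫ φ ‖w(s)‖²` (Fubini on `(s, t) × E`, the integrand
being continuous with compact `x`-support, and the fundamental theorem of calculus on each time
line; the pattern of Leray 1934, §17, (3.1) ⇒ (3.4)). [folklore] -/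
theorem IsSmoothSpaceTimeOn.integral_Ioo_integral_mul_inner_timeDerivWithin {T : ℝ}
    {w : ℝ → E → F'} (hw : IsSmoothSpaceTimeOn (Icc 0 T) w) (hT : 0 < T) {φ : E → ℝ}
    (hφ : Continuous φ) (hc : HasCompactSupport φ) {s t : ℝ} (hs : 0 ≤ s) (hst : s ≤ t)
    (ht : t ≤ T) :
    ∫ τ in Ioo s t, ∫ x, φ x * ⟪FluidPDE.timeDerivWithin (Icc 0 T) w τ x, w τ x⟫ =
      2⁻¹ * (∫ x, φ x * ‖w t x‖ ^ 2) - 2⁻¹ * (∫ x, φ x * ‖w s x‖ ^ 2) := by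
  have hU : UniqueDiffOn ℝ (Icc 0 T) := uniqueDiffOn_Icc hT
  have hu_cont : ContinuousOn (uncurry w) (Icc 0 T ×ˢ univ) := hw.continuousOn
  have hdt_cont : ContinuousOn (uncurry (FluidPDE.timeDerivWithin (Icc 0 T) w)) (Icc 0 T ×ˢ univ) :=
    (hw.timeDerivWithin hU).continuousOn
  have hsub : Icc s t ×ˢ (univ : Set E) ⊆ Icc 0 T ×ˢ univ :=
    prod_mono (Icc_subset_Icc hs ht) Subset.rfl
  have hKφ : ∀ x ∉ tsupport φ, φ x = 0 := fun x hx => image_eq_zero_of_notMem_tsupport hx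
  set D : ℝ × E → ℝ := fun z => φ z.2 * ⟪FluidPDE.timeDerivWithin (Icc 0 T) w z.1 z.2, w z.1 z.2⟫
    with hD
  have hDcont : ContinuousOn D (Icc s t ×ˢ univ) :=
    (hφ.comp continuous_snd).continuousOn.mul ((hdt_cont.mono hsub).inner (hu_cont.mono hsub))
  have hDK : ∀ τ ∈ Icc s t, ∀ x ∉ tsupport φ, D (τ, x) = 0 := fun τ _ x hx => by
    simp [hD, hKφ x hx]
  have hDint := integrable_prod_of_continuousOn hc hDcont hDK
  have hswap := integral_integral_swap (f := fun τ x => D (τ, x)) hDint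
  simp only [hD] at hswap
  rw [hswap]
  have hslice : ∀ {r : ℝ}, r ∈ Icc 0 T →
      Integrable (fun x => φ x * ‖w r x‖ ^ 2) (volume : Measure E) := fun hr =>
    (hφ.mul ((hw.contDiff_slice hr).continuous.norm.pow 2)).integrable_of_hasCompactSupport
      hc.mul_right
  have htI : t ∈ Icc 0 T := ⟨hs.trans hst, ht⟩
  have hsI : s ∈ Icc 0 T := ⟨hs, hst.trans ht⟩
  have hline : ∀ x, ∫ τ in Ioo s t, φ x * ⟪FluidPDE.timeDerivWithin (Icc 0 T) w τ x, w τ x⟫ =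
      2⁻¹ * (φ x * ‖w t x‖ ^ 2) - 2⁻¹ * (φ x * ‖w s x‖ ^ 2) := by
    intro x
    rcases eq_or_lt_of_le hst with rfl | hst'
    · simp
    have hcont : ContinuousOn (fun τ => 2⁻¹ * (φ x * ‖w τ x‖ ^ 2)) (Icc s t) := by
      refine continuousOn_const.mul (continuousOn_const.mul (ContinuousOn.pow ?_ 2))
      exact (hu_cont.comp (Continuous.prodMk_left x).continuousOn
        fun τ hτ => mk_mem_prod (Icc_subset_Icc hs ht hτ) (mem_univ x)).norm
    have hderiv : ∀ τ ∈ Ioo s t, HasDerivWithinAt (fun τ => 2⁻¹ * (φ x * ‖w τ x‖ ^ 2))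
        (φ x * ⟪FluidPDE.timeDerivWithin (Icc 0 T) w τ x, w τ x⟫) (Ioi τ) τ := by
      intro τ hτ
      have hτ0 : τ ∈ Ioo 0 T := ⟨hs.trans_lt hτ.1, hτ.2.trans_le ht⟩
      have hu' : HasDerivAt (fun σ => w σ x) (FluidPDE.timeDerivWithin (Icc 0 T) w τ x) τ :=
        (hw.hasDerivWithinAt_timeDerivWithin hU (Ioo_subset_Icc_self hτ0) x).hasDerivAt
          (Icc_mem_nhds hτ0.1 hτ0.2)
      have h2 := ((hu'.inner ℝ hu').const_mul (2⁻¹ * φ x)).hasDerivWithinAt (s := Ioi τ)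
      have hfun : (fun σ => 2⁻¹ * φ x * ⟪w σ x, w σ x⟫) = fun σ => 2⁻¹ * (φ x * ‖w σ x‖ ^ 2) := by
        funext σ
        rw [real_inner_self_eq_norm_sq]
        ring
      rw [hfun] at h2
      refine h2.congr_deriv ?_
      rw [real_inner_comm]
      ring
    have hint : IntervalIntegrable
        (fun τ => φ x * ⟪FluidPDE.timeDerivWithin (Icc 0 T) w τ x, w τ x⟫) volume s t := by
      refine ContinuousOn.intervalIntegrable ?_
      rw [uIcc_of_le hst]
      exact hDcont.comp (Continuous.prodMk_left x).continuousOn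
        fun τ hτ => mk_mem_prod hτ (mem_univ x)
    have := intervalIntegral.integral_eq_sub_of_hasDeriv_right_of_le hst hcont hderiv hint
    rw [intervalIntegral.integral_of_le hst, integral_Ioc_eq_integral_Ioo] at this
    rw [this]
  rw [integral_congr_ae (Eventually.of_forall hline), integral_sub ((hslice htI).const_mul _)
    ((hslice hsI).const_mul _), integral_const_mul, integral_const_mul]

/-- The scalar case of `integral_Ioo_integral_mul_inner_timeDerivWithin`:
`∫ₛᵗ ∫ φ (∂ₜ w) w dx dτ = ½ ∫ φ w(t)² − ½ ∫ φ w(s)²`. [folklore] -/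
theorem IsSmoothSpaceTimeOn.integral_Ioo_integral_mul_timeDerivWithin_mul {T : ℝ}
    {w : ℝ → E → ℝ} (hw : IsSmoothSpaceTimeOn (Icc 0 T) w) (hT : 0 < T) {φ : E → ℝ}
    (hφ : Continuous φ) (hc : HasCompactSupport φ) {s t : ℝ} (hs : 0 ≤ s) (hst : s ≤ t)
    (ht : t ≤ T) :
    ∫ τ in Ioo s t, ∫ x, φ x * (FluidPDE.timeDerivWithin (Icc 0 T) w τ x * w τ x) =
      2⁻¹ * (∫ x, φ x * w t x ^ 2) - 2⁻¹ * (∫ x, φ x * w s x ^ 2) := by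
  have h := hw.integral_Ioo_integral_mul_inner_timeDerivWithin hT hφ hc hs hst ht
  simp only [Real.inner_apply, Real.norm_eq_abs, sq_abs] at h
  exact h

end TimeIntegration

/-! ## Real-variable forms of Cauchy–Schwarz, `L⁴` interpolation, weighted AM–GM and Sobolev -/

section Inequalities

variable {α : Type*} [MeasurableSpace α] {μ : Measure α}
variable {G₁ G₂ : Type*} [NormedAddCommGroup G₁] [NormedAddCommGroup G₂]

/-- **Cauchy–Schwarz** for norms of `L²` functions:
`∫ ‖f‖ ‖g‖ ≤ (∫ ‖f‖²)^{1/2} (∫ ‖g‖²)^{1/2}`. [folklore] -/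
theorem integral_norm_mul_norm_le_sqrt_mul_sqrt {f : α → G₁} {g : α → G₂} (hf : MemLp f 2 μ)
    (hg : MemLp g 2 μ) :
    ∫ x, ‖f x‖ * ‖g x‖ ∂μ ≤
      Real.sqrt (∫ x, ‖f x‖ ^ 2 ∂μ) * Real.sqrt (∫ x, ‖g x‖ ^ 2 ∂μ) := by
  have h := integral_mul_norm_le_Lp_mul_Lq (μ := μ) (f := fun x => ‖f x‖) (g := fun x => ‖g x‖)
    Real.HolderConjugate.two_two (by simpa using hf.norm) (by simpa using hg.norm)
  simp only [norm_norm, Real.rpow_two, one_div, Real.sqrt_eq_rpow] at h ⊢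
  exact h

/-- **Cauchy–Schwarz** for real `L²` functions: `∫ f g ≤ (∫ f²)^{1/2} (∫ g²)^{1/2}`. [folklore] -/
theorem integral_mul_le_sqrt_mul_sqrt_of_memLp {f g : α → ℝ} (hf : MemLp f 2 μ) (hg : MemLp g 2 μ) :
    ∫ x, f x * g x ∂μ ≤ Real.sqrt (∫ x, f x ^ 2 ∂μ) * Real.sqrt (∫ x, g x ^ 2 ∂μ) := by
  have h := integral_norm_mul_norm_le_sqrt_mul_sqrt hf hg
  simp only [Real.norm_eq_abs, sq_abs] at h
  refine le_trans ?_ h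
  refine (le_abs_self _).trans ((abs_integral_le_integral_abs).trans (le_of_eq ?_))
  exact integral_congr_ae (Eventually.of_forall fun x => abs_mul _ _)

/-- **`L⁴` interpolation between `L²` and `L⁶`**: `∫ ‖g‖⁴ ≤ (∫ ‖g‖²)^{1/2} (∫ ‖g‖⁶)^{1/2}`
(Cauchy–Schwarz on `‖g‖ · ‖g‖³`). [folklore] -/
theorem integral_norm_pow_four_le {g : α → G₁} (h2 : MemLp g 2 μ) (h6 : MemLp g 6 μ) :
    ∫ x, ‖g x‖ ^ 4 ∂μ ≤ Real.sqrt (∫ x, ‖g x‖ ^ 2 ∂μ) * Real.sqrt (∫ x, ‖g x‖ ^ 6 ∂μ) := by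
  have h3 : MemLp (fun x => ‖g x‖ ^ 3) 2 μ := by
    have := h6.norm_rpow_div 3
    have e : (6 : ℝ≥0∞) / 3 = 2 := by
      rw [show (6 : ℝ≥0∞) = 2 * 3 by norm_num,
        ENNReal.mul_div_cancel_right (by norm_num) (by norm_num)]
    rw [e] at this
    refine this.ae_eq (Eventually.of_forall fun x => ?_)
    simp only [ENNReal.toReal_ofNat]
    exact_mod_cast Real.rpow_natCast ‖g x‖ 3
  have h := integral_norm_mul_norm_le_sqrt_mul_sqrt h2 h3
  have e1 : ∀ x, ‖g x‖ * ‖‖g x‖ ^ 3‖ = ‖g x‖ ^ 4 := fun x => by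
    rw [Real.norm_of_nonneg (pow_nonneg (norm_nonneg _) 3)]; ring
  have e2 : ∀ x, ‖‖g x‖ ^ 3‖ ^ 2 = ‖g x‖ ^ 6 := fun x => by
    rw [Real.norm_of_nonneg (pow_nonneg (norm_nonneg _) 3)]; ring
  simp only [e1, e2] at h
  exact h

/-- `(ε⁻¹)³` to the power `1/8` is `ε^{-3/8}`. [folklore] -/
theorem inv_pow_three_rpow_one_eighth {ε : ℝ} (hε : 0 < ε) :
    (ε⁻¹ ^ 3) ^ (1 / 8 : ℝ) = ε ^ (-(3 / 8) : ℝ) := by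
  rw [← Real.rpow_natCast, ← Real.rpow_mul (inv_nonneg.2 hε.le), Real.inv_rpow hε.le,
    ← Real.rpow_neg hε.le]
  norm_num

/-- **Weighted AM–GM, three terms, with a free parameter**: for `a, b, c ≥ 0` and `ε > 0`,
`a^{1/2} b^{1/8} c^{3/8} ≤ ½ a + ⅛ ε⁻³ b + ⅜ ε c`. [folklore] -/
theorem rpow_amgm₃ {a b c ε : ℝ} (ha : 0 ≤ a) (hb : 0 ≤ b) (hc : 0 ≤ c) (hε : 0 < ε) :
    a ^ (1 / 2 : ℝ) * b ^ (1 / 8 : ℝ) * c ^ (3 / 8 : ℝ) ≤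
      1 / 2 * a + 1 / 8 * (ε⁻¹ ^ 3 * b) + 3 / 8 * (ε * c) := by
  have hε3 : 0 ≤ ε⁻¹ ^ 3 := pow_nonneg (inv_nonneg.2 hε.le) 3
  have h := Real.geom_mean_le_arith_mean3_weighted (w₁ := 1 / 2) (w₂ := 1 / 8) (w₃ := 3 / 8)
    (p₁ := a) (p₂ := ε⁻¹ ^ 3 * b) (p₃ := ε * c) (by norm_num) (by norm_num) (by norm_num) ha
    (mul_nonneg hε3 hb) (mul_nonneg hε.le hc) (by norm_num)
  refine le_trans (le_of_eq ?_) h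
  rw [Real.mul_rpow hε3 hb, Real.mul_rpow hε.le hc]
  have key : (ε⁻¹ ^ 3) ^ (1 / 8 : ℝ) * ε ^ (3 / 8 : ℝ) = 1 := by
    rw [inv_pow_three_rpow_one_eighth hε, ← Real.rpow_add hε]
    norm_num
  calc a ^ (1 / 2 : ℝ) * b ^ (1 / 8 : ℝ) * c ^ (3 / 8 : ℝ)
      = a ^ (1 / 2 : ℝ) * b ^ (1 / 8 : ℝ) * c ^ (3 / 8 : ℝ) *
          ((ε⁻¹ ^ 3) ^ (1 / 8 : ℝ) * ε ^ (3 / 8 : ℝ)) := by rw [key, mul_one]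
    _ = a ^ (1 / 2 : ℝ) * ((ε⁻¹ ^ 3) ^ (1 / 8 : ℝ) * b ^ (1 / 8 : ℝ)) *
          (ε ^ (3 / 8 : ℝ) * c ^ (3 / 8 : ℝ)) := by ring

/-- **Weighted AM–GM, four terms, with a free parameter**: for `P₁, P₂, Q₁, Q₂ ≥ 0` and `ε > 0`,
`(P₁P₂)^{1/8} (Q₁Q₂)^{3/8} ≤ ⅛ ε⁻³ (P₁ + P₂) + ⅜ ε (Q₁ + Q₂)`. [folklore] -/
theorem rpow_amgm₄ {P₁ P₂ Q₁ Q₂ ε : ℝ} (hP₁ : 0 ≤ P₁) (hP₂ : 0 ≤ P₂) (hQ₁ : 0 ≤ Q₁)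
    (hQ₂ : 0 ≤ Q₂) (hε : 0 < ε) :
    (P₁ * P₂) ^ (1 / 8 : ℝ) * (Q₁ * Q₂) ^ (3 / 8 : ℝ) ≤
      1 / 8 * (ε⁻¹ ^ 3 * (P₁ + P₂)) + 3 / 8 * (ε * (Q₁ + Q₂)) := by
  have hε3 : 0 ≤ ε⁻¹ ^ 3 := pow_nonneg (inv_nonneg.2 hε.le) 3
  have h := Real.geom_mean_le_arith_mean4_weighted (w₁ := 1 / 8) (w₂ := 1 / 8) (w₃ := 3 / 8)
    (w₄ := 3 / 8) (p₁ := ε⁻¹ ^ 3 * P₁) (p₂ := ε⁻¹ ^ 3 * P₂) (p₃ := ε * Q₁) (p₄ := ε * Q₂)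
    (by norm_num) (by norm_num) (by norm_num) (by norm_num) (mul_nonneg hε3 hP₁)
    (mul_nonneg hε3 hP₂) (mul_nonneg hε.le hQ₁) (mul_nonneg hε.le hQ₂) (by norm_num)
  refine le_trans (le_of_eq ?_) (h.trans (le_of_eq (by ring)))
  rw [Real.mul_rpow hε3 hP₁, Real.mul_rpow hε3 hP₂, Real.mul_rpow hε.le hQ₁,
    Real.mul_rpow hε.le hQ₂, Real.mul_rpow hP₁ hP₂, Real.mul_rpow hQ₁ hQ₂]
  have key : (ε⁻¹ ^ 3) ^ (1 / 8 : ℝ) * (ε⁻¹ ^ 3) ^ (1 / 8 : ℝ) *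
      (ε ^ (3 / 8 : ℝ) * ε ^ (3 / 8 : ℝ)) = 1 := by
    rw [inv_pow_three_rpow_one_eighth hε, ← Real.rpow_add hε, ← Real.rpow_add hε,
      ← Real.rpow_add hε]
    norm_num
  calc P₁ ^ (1 / 8 : ℝ) * P₂ ^ (1 / 8 : ℝ) * (Q₁ ^ (3 / 8 : ℝ) * Q₂ ^ (3 / 8 : ℝ))
      = P₁ ^ (1 / 8 : ℝ) * P₂ ^ (1 / 8 : ℝ) * (Q₁ ^ (3 / 8 : ℝ) * Q₂ ^ (3 / 8 : ℝ)) *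
        ((ε⁻¹ ^ 3) ^ (1 / 8 : ℝ) * (ε⁻¹ ^ 3) ^ (1 / 8 : ℝ) *
          (ε ^ (3 / 8 : ℝ) * ε ^ (3 / 8 : ℝ))) := by rw [key, mul_one]
    _ = (ε⁻¹ ^ 3) ^ (1 / 8 : ℝ) * P₁ ^ (1 / 8 : ℝ) * ((ε⁻¹ ^ 3) ^ (1 / 8 : ℝ) * P₂ ^ (1 / 8 : ℝ)) *
        (ε ^ (3 / 8 : ℝ) * Q₁ ^ (3 / 8 : ℝ)) * (ε ^ (3 / 8 : ℝ) * Q₂ ^ (3 / 8 : ℝ)) := by ring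

/-- `√(√A₁ √A₂) = (A₁A₂)^{1/4}` and monotonicity: if `0 ≤ Aᵢ ≤ √Pᵢ K³ Qᵢ^{3/2}` then
`√(√A₁ √A₂) ≤ K^{3/2} (P₁P₂)^{1/8} (Q₁Q₂)^{3/8}`. [folklore] -/
theorem sqrt_sqrt_mul_sqrt_le {A₁ A₂ P₁ P₂ Q₁ Q₂ K : ℝ} (hA₁ : 0 ≤ A₁) (hA₂ : 0 ≤ A₂)
    (hP₁ : 0 ≤ P₁) (hP₂ : 0 ≤ P₂) (hQ₁ : 0 ≤ Q₁) (hQ₂ : 0 ≤ Q₂) (hK : 0 ≤ K)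
    (h₁ : A₁ ≤ Real.sqrt P₁ * (K ^ 3 * Q₁ ^ (3 / 2 : ℝ)))
    (h₂ : A₂ ≤ Real.sqrt P₂ * (K ^ 3 * Q₂ ^ (3 / 2 : ℝ))) :
    Real.sqrt (Real.sqrt A₁ * Real.sqrt A₂) ≤
      K ^ (3 / 2 : ℝ) * ((P₁ * P₂) ^ (1 / 8 : ℝ) * (Q₁ * Q₂) ^ (3 / 8 : ℝ)) := by
  have hprod : A₁ * A₂ ≤ K ^ 6 * (P₁ * P₂) ^ (1 / 2 : ℝ) * (Q₁ * Q₂) ^ (3 / 2 : ℝ) := by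
    calc A₁ * A₂ ≤ (Real.sqrt P₁ * (K ^ 3 * Q₁ ^ (3 / 2 : ℝ))) *
          (Real.sqrt P₂ * (K ^ 3 * Q₂ ^ (3 / 2 : ℝ))) :=
          mul_le_mul h₁ h₂ hA₂ (by positivity)
      _ = K ^ 6 * (P₁ * P₂) ^ (1 / 2 : ℝ) * (Q₁ * Q₂) ^ (3 / 2 : ℝ) := by
          rw [Real.sqrt_eq_rpow, Real.sqrt_eq_rpow, Real.mul_rpow hP₁ hP₂, Real.mul_rpow hQ₁ hQ₂]
          ring
  have hlhs : Real.sqrt (Real.sqrt A₁ * Real.sqrt A₂) = (A₁ * A₂) ^ (1 / 4 : ℝ) := by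
    rw [← Real.sqrt_mul hA₁, Real.sqrt_eq_rpow, Real.sqrt_eq_rpow,
      ← Real.rpow_mul (mul_nonneg hA₁ hA₂)]
    norm_num
  have hrhs : K ^ (3 / 2 : ℝ) * ((P₁ * P₂) ^ (1 / 8 : ℝ) * (Q₁ * Q₂) ^ (3 / 8 : ℝ)) =
      (K ^ 6 * (P₁ * P₂) ^ (1 / 2 : ℝ) * (Q₁ * Q₂) ^ (3 / 2 : ℝ)) ^ (1 / 4 : ℝ) := by
    have hPP : 0 ≤ P₁ * P₂ := mul_nonneg hP₁ hP₂
    have hQQ : 0 ≤ Q₁ * Q₂ := mul_nonneg hQ₁ hQ₂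
    rw [Real.mul_rpow (by positivity) (Real.rpow_nonneg hQQ _),
      Real.mul_rpow (by positivity) (Real.rpow_nonneg hPP _), ← Real.rpow_natCast K 6,
      ← Real.rpow_mul hK, ← Real.rpow_mul hPP, ← Real.rpow_mul hQQ]
    norm_num
    ring
  rw [hlhs, hrhs]
  exact Real.rpow_le_rpow (mul_nonneg hA₁ hA₂) hprod (by norm_num)

end Inequalities

section Sobolev

variable {E : Type*} [NormedAddCommGroup E] [NormedSpace ℝ E] [MeasurableSpace E] [BorelSpace E]
  [FiniteDimensional ℝ E] (μ : Measure E) [μ.IsAddHaarMeasure]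
variable {F : Type*} [NormedAddCommGroup F] [InnerProductSpace ℝ F]

omit [NormedSpace ℝ E] [FiniteDimensional ℝ E] [InnerProductSpace ℝ F] [μ.IsAddHaarMeasure] in
/-- For a continuous compactly supported `Φ`, `‖Φ‖_{L^p} = (∫ ‖Φ‖^p)^{1/p}` as an `ofReal`
(`p ≥ 1` a natural number). [folklore] -/
theorem eLpNorm_eq_ofReal_rpow_of_continuous [IsFiniteMeasureOnCompacts μ] {Φ : E → F}
    (hΦ : Continuous Φ) (hc : HasCompactSupport Φ) {p : ℕ} (hp : p ≠ 0) :
    eLpNorm Φ p μ = ENNReal.ofReal ((∫ x, ‖Φ x‖ ^ p ∂μ) ^ (p : ℝ)⁻¹) := by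
  have hmem : MemLp Φ p μ := hΦ.memLp_of_hasCompactSupport hc
  rw [hmem.eLpNorm_eq_integral_rpow_norm (by exact_mod_cast hp) (by simp)]
  simp [Real.rpow_natCast]

/-- **Gagliardo–Nirenberg–Sobolev in dimension three, real form**: for a `C¹` compactly supported
`Φ` on a `3`-dimensional space, `(∫ ‖Φ‖⁶)^{1/6} ≤ K (∫ ‖DΦ‖²)^{1/2}` with
`K = eLpNormLESNormFDerivOfEqInnerConst μ 2` (Mathlib's `eLpNorm_le_eLpNorm_fderiv_of_eq`, `p = 2`,
`p' = 6`). [folklore] -/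
theorem rpow_integral_norm_pow_six_le (hE : Module.finrank ℝ E = 3) {Φ : E → F}
    (hΦ : ContDiff ℝ 1 Φ) (hc : HasCompactSupport Φ) :
    (∫ x, ‖Φ x‖ ^ 6 ∂μ) ^ (6 : ℝ)⁻¹ ≤
      (eLpNormLESNormFDerivOfEqInnerConst μ 2 : ℝ) * (∫ x, ‖fderiv ℝ Φ x‖ ^ 2 ∂μ) ^ (2 : ℝ)⁻¹ := by
  have h := eLpNorm_le_eLpNorm_fderiv_of_eq_inner μ hΦ hc (p := 2) (p' := 6) one_le_two
    (by rw [hE]; norm_num) (by rw [hE]; norm_num)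
  have h1 := eLpNorm_eq_ofReal_rpow_of_continuous μ hΦ.continuous hc (p := 6) (by norm_num)
  have h2 := eLpNorm_eq_ofReal_rpow_of_continuous μ (hΦ.continuous_fderiv one_ne_zero)
    (hc.fderiv ℝ) (p := 2) (by norm_num)
  push_cast at h1 h2
  rw [show ((6 : ℝ≥0) : ℝ≥0∞) = (6 : ℝ≥0∞) by norm_cast,
    show ((2 : ℝ≥0) : ℝ≥0∞) = (2 : ℝ≥0∞) by norm_cast, h1, h2,
    ← ENNReal.ofReal_coe_nnreal, ← ENNReal.ofReal_mul (NNReal.coe_nonneg _)] at h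
  exact (ENNReal.ofReal_le_ofReal_iff (mul_nonneg (NNReal.coe_nonneg _)
    (Real.rpow_nonneg (integral_nonneg fun _ => sq_nonneg _) _))).1 h

/-- The same in the form `∫ ‖Φ‖⁶ ≤ K⁶ (∫ ‖DΦ‖²)³`. [folklore] -/
theorem integral_norm_pow_six_le (hE : Module.finrank ℝ E = 3) {Φ : E → F}
    (hΦ : ContDiff ℝ 1 Φ) (hc : HasCompactSupport Φ) :
    ∫ x, ‖Φ x‖ ^ 6 ∂μ ≤
      (eLpNormLESNormFDerivOfEqInnerConst μ 2 : ℝ) ^ 6 * (∫ x, ‖fderiv ℝ Φ x‖ ^ 2 ∂μ) ^ 3 := by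
  have h := rpow_integral_norm_pow_six_le μ hE hΦ hc
  have hI : 0 ≤ ∫ x, ‖Φ x‖ ^ 6 ∂μ := integral_nonneg fun _ => pow_nonneg (norm_nonneg _) _
  have hJ : 0 ≤ ∫ x, ‖fderiv ℝ Φ x‖ ^ 2 ∂μ := integral_nonneg fun _ => sq_nonneg _
  have h6 := pow_le_pow_left₀ (Real.rpow_nonneg hI _) h 6
  have eI : ((∫ x, ‖Φ x‖ ^ 6 ∂μ) ^ (6 : ℝ)⁻¹) ^ 6 = ∫ x, ‖Φ x‖ ^ 6 ∂μ := by
    exact_mod_cast Real.rpow_inv_natCast_pow hI (n := 6) (by norm_num)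
  have eJ : ((∫ x, ‖fderiv ℝ Φ x‖ ^ 2 ∂μ) ^ (2 : ℝ)⁻¹) ^ 2 = ∫ x, ‖fderiv ℝ Φ x‖ ^ 2 ∂μ := by
    exact_mod_cast Real.rpow_inv_natCast_pow hJ (n := 2) (by norm_num)
  have e6 : ((∫ x, ‖fderiv ℝ Φ x‖ ^ 2 ∂μ) ^ (2 : ℝ)⁻¹) ^ 6 = (∫ x, ‖fderiv ℝ Φ x‖ ^ 2 ∂μ) ^ 3 := by
    rw [show 6 = 2 * 3 from rfl, pow_mul, eJ]
  rw [eI, mul_pow, e6] at h6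
  exact h6

/-- **The `L⁴` bound**: `∫ ‖Φ‖⁴ ≤ (∫ ‖Φ‖²)^{1/2} K³ (∫ ‖DΦ‖²)^{3/2}` for `C¹` compactly supported
`Φ` in dimension three (interpolation `‖Φ‖₄ ≤ ‖Φ‖₂^{1/4} ‖Φ‖₆^{3/4}` and Sobolev). [folklore] -/
theorem integral_norm_pow_four_le_of_hasCompactSupport (hE : Module.finrank ℝ E = 3) {Φ : E → F}
    (hΦ : ContDiff ℝ 1 Φ) (hc : HasCompactSupport Φ) :
    ∫ x, ‖Φ x‖ ^ 4 ∂μ ≤ Real.sqrt (∫ x, ‖Φ x‖ ^ 2 ∂μ) *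
      ((eLpNormLESNormFDerivOfEqInnerConst μ 2 : ℝ) ^ 3 *
        (∫ x, ‖fderiv ℝ Φ x‖ ^ 2 ∂μ) ^ (3 / 2 : ℝ)) := by
  have hJ : 0 ≤ ∫ x, ‖fderiv ℝ Φ x‖ ^ 2 ∂μ := integral_nonneg fun _ => sq_nonneg _
  have hK : 0 ≤ (eLpNormLESNormFDerivOfEqInnerConst μ 2 : ℝ) := NNReal.coe_nonneg _
  have h4 := integral_norm_pow_four_le (μ := μ) (hΦ.continuous.memLp_of_hasCompactSupport hc)
    (hΦ.continuous.memLp_of_hasCompactSupport hc)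
  refine h4.trans (mul_le_mul_of_nonneg_left ?_ (Real.sqrt_nonneg _))
  calc Real.sqrt (∫ x, ‖Φ x‖ ^ 6 ∂μ)
      ≤ Real.sqrt ((eLpNormLESNormFDerivOfEqInnerConst μ 2 : ℝ) ^ 6 *
          (∫ x, ‖fderiv ℝ Φ x‖ ^ 2 ∂μ) ^ 3) :=
        Real.sqrt_le_sqrt (integral_norm_pow_six_le μ hE hΦ hc)
    _ = (eLpNormLESNormFDerivOfEqInnerConst μ 2 : ℝ) ^ 3 * (∫ x, ‖fderiv ℝ Φ x‖ ^ 2 ∂μ) ^ (3 / 2 : ℝ) := by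
        rw [Real.sqrt_mul (pow_nonneg hK 6),
          show (eLpNormLESNormFDerivOfEqInnerConst μ 2 : ℝ) ^ 6 =
            ((eLpNormLESNormFDerivOfEqInnerConst μ 2 : ℝ) ^ 3) ^ 2 by ring,
          Real.sqrt_sq (pow_nonneg hK 3), Real.sqrt_eq_rpow]
        congr 1
        rw [← Real.rpow_natCast (∫ x, ‖fderiv ℝ Φ x‖ ^ 2 ∂μ) 3, ← Real.rpow_mul hJ]
        norm_num

/-- **The trilinear estimate, multiplicative form**: for `f ∈ L²` and `C¹` compactly supported
`Φ₁`, `Φ₂` in dimension three and `K ≥ eLpNormLESNormFDerivOfEqInnerConst μ 2`,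
`∫ ‖f‖ ‖Φ₁‖ ‖Φ₂‖ ≤ ‖f‖₂ K^{3/2} (‖Φ₁‖₂² ‖Φ₂‖₂²)^{1/8} (‖DΦ₁‖₂² ‖DΦ₂‖₂²)^{3/8}`
(Cauchy–Schwarz twice and the `L⁴` bound: `‖Φ‖₄ ≤ ‖Φ‖₂^{1/4} (K ‖DΦ‖₂)^{3/4}`). [folklore] -/
theorem integral_norm_mul_norm_mul_norm_le_rpow (hE : Module.finrank ℝ E = 3) {G : Type*}
    [NormedAddCommGroup G] {F₂ : Type*} [NormedAddCommGroup F₂] [InnerProductSpace ℝ F₂]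
    {f : E → G} (hf : MemLp f 2 μ) {Φ₁ : E → F} {Φ₂ : E → F₂}
    (h₁ : ContDiff ℝ 1 Φ₁) (c₁ : HasCompactSupport Φ₁) (h₂ : ContDiff ℝ 1 Φ₂)
    (c₂ : HasCompactSupport Φ₂) {K : ℝ} (hK : (eLpNormLESNormFDerivOfEqInnerConst μ 2 : ℝ) ≤ K) :
    ∫ x, ‖f x‖ * (‖Φ₁ x‖ * ‖Φ₂ x‖) ∂μ ≤
      Real.sqrt (∫ x, ‖f x‖ ^ 2 ∂μ) * (K ^ (3 / 2 : ℝ) *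
        ((((∫ x, ‖Φ₁ x‖ ^ 2 ∂μ) * ∫ x, ‖Φ₂ x‖ ^ 2 ∂μ) ^ (1 / 8 : ℝ)) *
          (((∫ x, ‖fderiv ℝ Φ₁ x‖ ^ 2 ∂μ) * ∫ x, ‖fderiv ℝ Φ₂ x‖ ^ 2 ∂μ) ^ (3 / 8 : ℝ)))) := by
  have hK₁0 : 0 ≤ (eLpNormLESNormFDerivOfEqInnerConst μ 2 : ℝ) := NNReal.coe_nonneg _
  have hK0 : 0 ≤ K := hK₁0.trans hK
  have hP₁0 : 0 ≤ ∫ x, ‖Φ₁ x‖ ^ 2 ∂μ := integral_nonneg fun _ => sq_nonneg _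
  have hP₂0 : 0 ≤ ∫ x, ‖Φ₂ x‖ ^ 2 ∂μ := integral_nonneg fun _ => sq_nonneg _
  have hQ₁0 : 0 ≤ ∫ x, ‖fderiv ℝ Φ₁ x‖ ^ 2 ∂μ := integral_nonneg fun _ => sq_nonneg _
  have hQ₂0 : 0 ≤ ∫ x, ‖fderiv ℝ Φ₂ x‖ ^ 2 ∂μ := integral_nonneg fun _ => sq_nonneg _
  have hA₁0 : 0 ≤ ∫ x, ‖Φ₁ x‖ ^ 4 ∂μ := integral_nonneg fun _ => pow_nonneg (norm_nonneg _) _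
  have hA₂0 : 0 ≤ ∫ x, ‖Φ₂ x‖ ^ 4 ∂μ := integral_nonneg fun _ => pow_nonneg (norm_nonneg _) _
  -- the `L⁴` bounds, with the common constant `K`
  have hA₁ : ∫ x, ‖Φ₁ x‖ ^ 4 ∂μ ≤ Real.sqrt (∫ x, ‖Φ₁ x‖ ^ 2 ∂μ) *
      (K ^ 3 * (∫ x, ‖fderiv ℝ Φ₁ x‖ ^ 2 ∂μ) ^ (3 / 2 : ℝ)) := by
    refine (integral_norm_pow_four_le_of_hasCompactSupport μ hE h₁ c₁).trans ?_
    refine mul_le_mul_of_nonneg_left (mul_le_mul_of_nonneg_right ?_ (Real.rpow_nonneg hQ₁0 _))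
      (Real.sqrt_nonneg _)
    exact pow_le_pow_left₀ hK₁0 hK 3
  have hA₂ : ∫ x, ‖Φ₂ x‖ ^ 4 ∂μ ≤ Real.sqrt (∫ x, ‖Φ₂ x‖ ^ 2 ∂μ) *
      (K ^ 3 * (∫ x, ‖fderiv ℝ Φ₂ x‖ ^ 2 ∂μ) ^ (3 / 2 : ℝ)) := by
    refine (integral_norm_pow_four_le_of_hasCompactSupport μ hE h₂ c₂).trans ?_
    refine mul_le_mul_of_nonneg_left (mul_le_mul_of_nonneg_right ?_ (Real.rpow_nonneg hQ₂0 _))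
      (Real.sqrt_nonneg _)
    exact pow_le_pow_left₀ hK₁0 hK 3
  -- `Φ₁ ⊗ Φ₂` in norm is in `L²`; first Cauchy–Schwarz
  have hprod : MemLp (fun x => ‖Φ₁ x‖ * ‖Φ₂ x‖) 2 μ :=
    (h₁.continuous.norm.mul h₂.continuous.norm).memLp_of_hasCompactSupport c₁.norm.mul_right
  have step1 : ∫ x, ‖f x‖ * (‖Φ₁ x‖ * ‖Φ₂ x‖) ∂μ ≤
      Real.sqrt (∫ x, ‖f x‖ ^ 2 ∂μ) * Real.sqrt (∫ x, (‖Φ₁ x‖ * ‖Φ₂ x‖) ^ 2 ∂μ) := by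
    have h := integral_norm_mul_norm_le_sqrt_mul_sqrt hf hprod
    have e : ∀ x, ‖‖Φ₁ x‖ * ‖Φ₂ x‖‖ = ‖Φ₁ x‖ * ‖Φ₂ x‖ := fun x =>
      Real.norm_of_nonneg (mul_nonneg (norm_nonneg _) (norm_nonneg _))
    simp only [e] at h
    exact h
  -- second Cauchy–Schwarz
  have cont₁ : Continuous fun x => ‖Φ₁ x‖ ^ 2 := h₁.continuous.norm.pow 2
  have cont₂ : Continuous fun x => ‖Φ₂ x‖ ^ 2 := h₂.continuous.norm.pow 2
  have supp₁ : HasCompactSupport fun x => ‖Φ₁ x‖ ^ 2 :=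
    c₁.norm.comp_left (g := fun r : ℝ => r ^ 2) (by norm_num)
  have supp₂ : HasCompactSupport fun x => ‖Φ₂ x‖ ^ 2 :=
    c₂.norm.comp_left (g := fun r : ℝ => r ^ 2) (by norm_num)
  have hsq₁ : MemLp (fun x => ‖Φ₁ x‖ ^ 2) 2 μ := cont₁.memLp_of_hasCompactSupport supp₁
  have hsq₂ : MemLp (fun x => ‖Φ₂ x‖ ^ 2) 2 μ := cont₂.memLp_of_hasCompactSupport supp₂
  have step2 : ∫ x, (‖Φ₁ x‖ * ‖Φ₂ x‖) ^ 2 ∂μ ≤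
      Real.sqrt (∫ x, ‖Φ₁ x‖ ^ 4 ∂μ) * Real.sqrt (∫ x, ‖Φ₂ x‖ ^ 4 ∂μ) := by
    have h := integral_mul_le_sqrt_mul_sqrt_of_memLp hsq₁ hsq₂
    have e1 : ∀ x, ‖Φ₁ x‖ ^ 2 * ‖Φ₂ x‖ ^ 2 = (‖Φ₁ x‖ * ‖Φ₂ x‖) ^ 2 := fun x => by ring
    have e2 : ∀ x, (‖Φ₁ x‖ ^ 2) ^ 2 = ‖Φ₁ x‖ ^ 4 := fun x => by ring
    have e3 : ∀ x, (‖Φ₂ x‖ ^ 2) ^ 2 = ‖Φ₂ x‖ ^ 4 := fun x => by ring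
    simp only [e1, e2, e3] at h
    exact h
  have step3 : Real.sqrt (∫ x, (‖Φ₁ x‖ * ‖Φ₂ x‖) ^ 2 ∂μ) ≤
      K ^ (3 / 2 : ℝ) * (((∫ x, ‖Φ₁ x‖ ^ 2 ∂μ) * ∫ x, ‖Φ₂ x‖ ^ 2 ∂μ) ^ (1 / 8 : ℝ) *
        ((∫ x, ‖fderiv ℝ Φ₁ x‖ ^ 2 ∂μ) * ∫ x, ‖fderiv ℝ Φ₂ x‖ ^ 2 ∂μ) ^ (3 / 8 : ℝ)) :=
    (Real.sqrt_le_sqrt step2).trans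
      (sqrt_sqrt_mul_sqrt_le hA₁0 hA₂0 hP₁0 hP₂0 hQ₁0 hQ₂0 hK0 hA₁ hA₂)
  exact step1.trans (mul_le_mul_of_nonneg_left step3 (Real.sqrt_nonneg _))

/-- **The trilinear estimate** behind the energy method: for `f ∈ L²` and `C¹` compactly supported
`Φ₁`, `Φ₂` in dimension three, `K ≥ eLpNormLESNormFDerivOfEqInnerConst μ 2`, and every
`ε > 0`,
`∫ ‖f‖ ‖Φ₁‖ ‖Φ₂‖ ≤ ‖f‖₂ K^{3/2} (⅛ ε⁻³ (‖Φ₁‖₂² + ‖Φ₂‖₂²) + ⅜ ε (‖DΦ₁‖₂² + ‖DΦ₂‖₂²))`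
(Cauchy–Schwarz twice, the `L⁴` bound, weighted AM–GM). [folklore] -/
theorem integral_norm_mul_norm_mul_norm_le (hE : Module.finrank ℝ E = 3) {G : Type*}
    [NormedAddCommGroup G] {F₂ : Type*} [NormedAddCommGroup F₂] [InnerProductSpace ℝ F₂]
    {f : E → G} (hf : MemLp f 2 μ) {Φ₁ : E → F} {Φ₂ : E → F₂}
    (h₁ : ContDiff ℝ 1 Φ₁) (c₁ : HasCompactSupport Φ₁) (h₂ : ContDiff ℝ 1 Φ₂)
    (c₂ : HasCompactSupport Φ₂) {K : ℝ} (hK : (eLpNormLESNormFDerivOfEqInnerConst μ 2 : ℝ) ≤ K)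
    {ε : ℝ} (hε : 0 < ε) :
    ∫ x, ‖f x‖ * (‖Φ₁ x‖ * ‖Φ₂ x‖) ∂μ ≤
      Real.sqrt (∫ x, ‖f x‖ ^ 2 ∂μ) * K ^ (3 / 2 : ℝ) *
        (1 / 8 * (ε⁻¹ ^ 3 * ((∫ x, ‖Φ₁ x‖ ^ 2 ∂μ) + ∫ x, ‖Φ₂ x‖ ^ 2 ∂μ)) +
          3 / 8 * (ε * ((∫ x, ‖fderiv ℝ Φ₁ x‖ ^ 2 ∂μ) + ∫ x, ‖fderiv ℝ Φ₂ x‖ ^ 2 ∂μ))) := by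
  have hK0 : 0 ≤ K := (NNReal.coe_nonneg _).trans hK
  have hP₁0 : 0 ≤ ∫ x, ‖Φ₁ x‖ ^ 2 ∂μ := integral_nonneg fun _ => sq_nonneg _
  have hP₂0 : 0 ≤ ∫ x, ‖Φ₂ x‖ ^ 2 ∂μ := integral_nonneg fun _ => sq_nonneg _
  have hQ₁0 : 0 ≤ ∫ x, ‖fderiv ℝ Φ₁ x‖ ^ 2 ∂μ := integral_nonneg fun _ => sq_nonneg _
  have hQ₂0 : 0 ≤ ∫ x, ‖fderiv ℝ Φ₂ x‖ ^ 2 ∂μ := integral_nonneg fun _ => sq_nonneg _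
  have step := integral_norm_mul_norm_mul_norm_le_rpow μ hE hf h₁ c₁ h₂ c₂ hK
  have step4 := rpow_amgm₄ hP₁0 hP₂0 hQ₁0 hQ₂0 hε
  refine step.trans ?_
  rw [mul_assoc]
  refine mul_le_mul_of_nonneg_left (mul_le_mul_of_nonneg_left step4 (Real.rpow_nonneg hK0 _))
    (Real.sqrt_nonneg _)

end Sobolev

/-! ## Grönwall's inequality in integral form -/

section Gronwall

/-- **Grönwall, integral form**: if `Z` is continuous on `[0, T]` and
`Z(t) ≤ A + C ∫₀ᵗ Z` there, with `C ≥ 0`, then `Z(t) ≤ A e^{Ct}` on `[0, T]` (apply Mathlib's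
differential Grönwall bound to `Ψ(t) = ∫₀ᵗ Z`, whose right derivative is `Z ≤ C Ψ + A`). [folklore] -/
theorem le_mul_exp_of_le_add_mul_integral {Z : ℝ → ℝ} {T A C : ℝ}
    (hZ : ContinuousOn Z (Icc 0 T)) (hC : 0 ≤ C)
    (hle : ∀ t ∈ Icc 0 T, Z t ≤ A + C * ∫ s in (0 : ℝ)..t, Z s) :
    ∀ t ∈ Icc 0 T, Z t ≤ A * Real.exp (C * t) := by
  intro t ht
  set Ψ : ℝ → ℝ := fun t => ∫ s in (0 : ℝ)..t, Z s with hΨ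
  -- `Ψ` is continuous on `[0, T]` with right derivative `Z`
  have hint : ∀ t ∈ Icc 0 T, IntervalIntegrable Z volume 0 t := fun t ht =>
    (hZ.mono (Icc_subset_Icc le_rfl ht.2)).intervalIntegrable_of_Icc ht.1
  have hΨcont : ContinuousOn Ψ (Icc 0 T) := by
    have := (intervalIntegral.continuousOn_primitive_interval' (hint T ⟨?_, le_rfl⟩)
      left_mem_uIcc)
    · rw [uIcc_of_le] at this
      · exact this
      · exact ht.1.trans ht.2
    · exact ht.1.trans ht.2
  have hΨderiv : ∀ x ∈ Ico 0 T, HasDerivWithinAt Ψ (Z x) (Ici x) x := by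
    intro x hx
    have hxT : x ∈ Icc 0 T := Ico_subset_Icc_self hx
    have hcont : ContinuousWithinAt Z (Ici x) x := by
      have h1 : ContinuousWithinAt Z (Icc 0 T) x := hZ x hxT
      have h2 : Icc x T ∈ 𝓝[Ici x] x := Icc_mem_nhdsGE hx.2
      exact (h1.mono (Icc_subset_Icc hx.1 le_rfl)).mono_of_mem_nhdsWithin h2
    have hmeas : StronglyMeasurableAtFilter Z (𝓝[>] x) volume := by
      refine ⟨Ioc x T, Ioc_mem_nhdsGT hx.2, ?_⟩
      exact ((hZ.mono (Ioc_subset_Icc_self.trans (Icc_subset_Icc hx.1 le_rfl))).aestronglyMeasurable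
        measurableSet_Ioc)
    exact intervalIntegral.integral_hasDerivWithinAt_right (hint x hxT) hmeas
      (hcont.mono Ioi_subset_Ici_self)
  have hΨ0 : Ψ 0 ≤ 0 := by simp [hΨ]
  have hbound : ∀ x ∈ Ico 0 T, Z x ≤ C * Ψ x + A := fun x hx => by
    rw [add_comm]; exact hle x (Ico_subset_Icc_self hx)
  have hG := le_gronwallBound_of_liminf_deriv_right_le hΨcont
    (fun x hx r hr => (hΨderiv x hx).liminf_right_slope_le hr) hΨ0 hbound t ht
  rw [sub_zero] at hG
  -- `Z t ≤ A + C Ψ t ≤ A + C · gronwallBound 0 C A t = A e^{Ct}`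
  have hZt := hle t ht
  by_cases hC0 : C = 0
  · subst hC0
    simpa using hZt
  · rw [gronwallBound_of_K_ne_0 hC0] at hG
    simp only [zero_mul, zero_add] at hG
    calc Z t ≤ A + C * Ψ t := hZt
      _ ≤ A + C * (A / C * (Real.exp (C * t) - 1)) := by
          gcongr
      _ = A * Real.exp (C * t) := by field_simp; ring

end Gronwall

end Literature.Analysis.FluidPDE


end
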